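import Summits.KontsevichZagierPeriods.KontsevichZagierPeriods.Theorems.RootDecompZetaThreeFrontierWordMatchPreludeP9a

/-! # `RootDecompZetaThreeFrontierWordMatchPreludeP9` — part 2/2 of the mechanical ≤230-line split of `P9src.lean`
(split by the decomp-kz census seat for landing; mathematics unchanged; part 2 continues part 1). -/

set_option linter.dupNamespace false

noncomputable section

namespace Summit.KontsevichZagierPeriods.KontsevichZagierPeriods.Theorems.RootDecompZetaThreeFrontierWordMoves

open Set MeasureTheory Literature.NumberTheory.Transcendental
open Literature.ModelTheory.ExponentialFields (IsSemialgebraic)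
open Summit.KontsevichZagierPeriods.RootDecompZetaThreeFrontier

section IBPT1

/-- Auxiliary step `sw3_snoc_zero`. [bookkeeping] -/
theorem sw3_snoc_zero (y : Fin 2 → ℝ) (s : ℝ) : sw3 (Fin.snoc y s) 0 = y 0 := rfl
/-- Auxiliary step `sw3_snoc_one`. [bookkeeping] -/
theorem sw3_snoc_one (y : Fin 2 → ℝ) (s : ℝ) : sw3 (Fin.snoc y s) 1 = s := rfl
/-- Auxiliary step `sw3_snoc_two`. [bookkeeping] -/
theorem sw3_snoc_two (y : Fin 2 → ℝ) (s : ℝ) : sw3 (Fin.snoc y s) 2 = y 1 := rfl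

/-- Auxiliary step `hasDerivAt_mid_apply`. [bookkeeping] -/
theorem hasDerivAt_mid_apply (y : Fin 2 → ℝ) (i : Fin 3) (t : ℝ) :
    HasDerivAt (fun s => sw3 (Fin.snoc y s) i)
      (MvPolynomial.aeval (sw3 (Fin.snoc y t)) (MvPolynomial.pderiv 1 (MvPolynomial.X i : MvPolynomial (Fin 3) ℚ))) t := by
  by_cases hi : i = 1
  · subst hi
    rw [MvPolynomial.pderiv_X_self, map_one]
    simp only [sw3_snoc_one]
    exact hasDerivAt_id t
  · rw [MvPolynomial.pderiv_X_of_ne hi, map_zero]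
    fin_cases i
    · exact hasDerivAt_const t (y 0)
    · exact absurd rfl hi
    · exact hasDerivAt_const t (y 1)

/-- differentiation of `s ↦ P(y₀, s, y₁)` is evaluation of `∂₁P` -/
theorem hasDerivAt_aeval_mid (y : Fin 2 → ℝ) (t : ℝ) (P : MvPolynomial (Fin 3) ℚ) :
    HasDerivAt (fun s => MvPolynomial.aeval (sw3 (Fin.snoc y s)) P)
      (MvPolynomial.aeval (sw3 (Fin.snoc y t)) (MvPolynomial.pderiv 1 P)) t := by
  induction P using MvPolynomial.induction_on with
  | C a =>
    simp only [MvPolynomial.aeval_C, MvPolynomial.pderiv_C, map_zero]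
    exact hasDerivAt_const t _
  | add p q hp hq =>
    simp only [map_add]
    exact hp.add hq
  | mul_X p i hp =>
    have hf : (fun s => MvPolynomial.aeval (sw3 (Fin.snoc y s)) (p * MvPolynomial.X i)) =
        fun s => MvPolynomial.aeval (sw3 (Fin.snoc y s)) p * sw3 (Fin.snoc y s) i :=
      funext fun s => by rw [map_mul, MvPolynomial.aeval_X]
    rw [hf, MvPolynomial.pderiv_mul, map_add, map_mul, map_mul, MvPolynomial.aeval_X]
    exact hp.mul (hasDerivAt_mid_apply y i t)

/-- Auxiliary step `continuous_aeval_mid`. [bookkeeping] -/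
theorem continuous_aeval_mid (y : Fin 2 → ℝ) (P : MvPolynomial (Fin 3) ℚ) :
    Continuous (fun s => MvPolynomial.aeval (sw3 (Fin.snoc y s)) P) :=
  continuous_iff_continuousAt.2 fun s => (hasDerivAt_aeval_mid y s P).continuousAt

/-- `P ↦ P(u₀, u₂, u₁)` -/
noncomputable def swP3 (P : MvPolynomial (Fin 3) ℚ) : MvPolynomial (Fin 3) ℚ :=
  MvPolynomial.bind₁ ![MvPolynomial.X 0, MvPolynomial.X 2, MvPolynomial.X 1] P

/-- Auxiliary step `aeval_swP3`. [bookkeeping] -/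
theorem aeval_swP3 (P : MvPolynomial (Fin 3) ℚ) (u : Fin 3 → ℝ) :
    MvPolynomial.aeval u (swP3 P) = MvPolynomial.aeval (sw3 u) P := by
  have e : (fun i => MvPolynomial.aeval u ((![MvPolynomial.X 0, MvPolynomial.X 2, MvPolynomial.X 1] :
      Fin 3 → MvPolynomial (Fin 3) ℚ) i)) = sw3 u := by
    funext i
    fin_cases i <;> simp [sw3_zero, sw3_one, sw3_two]
  rw [swP3, MvPolynomial.aeval_bind₁, e]

/-- the t₁-IBP numerator `∂₁P·t₁(1-t₁) + P·(γ₁ t₁ - β₁ (1-t₁))` -/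
noncomputable def ibpQ1 (P : MvPolynomial (Fin 3) ℚ) (β₁ γ₁ : ℕ) : MvPolynomial (Fin 3) ℚ :=
  MvPolynomial.pderiv 1 P * (MvPolynomial.X 1 * (MvPolynomial.C 1 - MvPolynomial.X 1)) +
    P * (MvPolynomial.C (γ₁ : ℚ) * MvPolynomial.X 1 - MvPolynomial.C (β₁ : ℚ) * (MvPolynomial.C 1 - MvPolynomial.X 1))

/-- the combined boundary numerator `P(y₀,y₀,y₁)·y₁^{β₁}(1-y₁)^{γ₁} - P(y₀,y₁,y₁)·y₀^{β₁}(1-y₀)^{γ₁} ∈ ℚ[y₀,y₁]` -/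
noncomputable def ibpB1 (P : MvPolynomial (Fin 3) ℚ) (β₁ γ₁ : ℕ) : MvPolynomial (Fin 2) ℚ :=
  MvPolynomial.bind₁ ![MvPolynomial.X 0, MvPolynomial.X 0, MvPolynomial.X 1] P * (MvPolynomial.X 1 ^ β₁ * (MvPolynomial.C 1 - MvPolynomial.X 1) ^ γ₁) -
    MvPolynomial.bind₁ ![MvPolynomial.X 0, MvPolynomial.X 1, MvPolynomial.X 1] P * (MvPolynomial.X 0 ^ β₁ * (MvPolynomial.C 1 - MvPolynomial.X 0) ^ γ₁)

/-- the 5-factor class read in swapped coordinates is semialgebraic on the closed band -/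
theorem layerF_sw_sa (P : MvPolynomial (Fin 3) ℚ) (β₀ β₁ γ₁ γ₂ α : ℕ) :
    IsSemialgebraicFunOn ℚ bandC3 (fun u => WordLayer.layerF P β₀ β₁ γ₁ γ₂ α (sw3 u)) := by
  refine (isSemialgebraicFunOn_aeval_div_aeval isSemialgebraic_bandC3 (swP3 P)
    (MvPolynomial.X 0 ^ β₀ * MvPolynomial.X 2 ^ β₁ * (MvPolynomial.C 1 - MvPolynomial.X 2) ^ γ₁ *
      (MvPolynomial.C 1 - MvPolynomial.X 1) ^ γ₂ * (MvPolynomial.X 0 - MvPolynomial.X 1) ^ α) fun z hz => ?_).congr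
    fun z hz => ?_
  · obtain ⟨h0, h2, h2', h1', hd⟩ := bandC3_facts hz
    simp only [map_mul, map_pow, map_sub, MvPolynomial.aeval_X, map_one]
    exact mul_ne_zero (mul_ne_zero (mul_ne_zero (mul_ne_zero (pow_ne_zero _ h0) (pow_ne_zero _ h2)) (pow_ne_zero _ h2'))
      (pow_ne_zero _ h1')) (pow_ne_zero _ hd)
  · simp only [map_mul, map_pow, map_sub, MvPolynomial.aeval_X, map_one, WordLayer.layerF, aeval_swP3, sw3_zero, sw3_one, sw3_two]

/-- Auxiliary step `layerF_sw_cont`. [bookkeeping] -/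
theorem layerF_sw_cont (P : MvPolynomial (Fin 3) ℚ) (β₀ β₁ γ₁ γ₂ α : ℕ) : ∀ y ∈ KZ.openOrderedSimplex 2,
    ContinuousOn (fun s => WordLayer.layerF P β₀ β₁ γ₁ γ₂ α (sw3 (Fin.snoc y s))) (Icc (y 1) (y 0)) := by
  intro y hy
  obtain ⟨h1, h10, h0⟩ := (mem_simplex_two_iff y).1 hy
  show ContinuousOn (fun s => MvPolynomial.aeval (sw3 (Fin.snoc y s)) P /
    (y 0 ^ β₀ * s ^ β₁ * (1 - s) ^ γ₁ * (1 - y 1) ^ γ₂ * (y 0 - y 1) ^ α)) (Icc (y 1) (y 0))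
  refine ContinuousOn.div (continuous_aeval_mid y P).continuousOn (by fun_prop) fun s hs => ?_
  have hs1 : y 1 ≤ s := hs.1
  have hs0 : s ≤ y 0 := hs.2
  have hy0 : y 0 ≠ 0 := by linarith
  have hs : s ≠ 0 := by linarith
  have hs' : (1 : ℝ) - s ≠ 0 := by linarith
  have hy1' : (1 : ℝ) - y 1 ≠ 0 := by linarith
  have hd : y 0 - y 1 ≠ 0 := by linarith
  exact mul_ne_zero (mul_ne_zero (mul_ne_zero (mul_ne_zero (pow_ne_zero _ hy0) (pow_ne_zero _ hs)) (pow_ne_zero _ hs'))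
    (pow_ne_zero _ hy1')) (pow_ne_zero _ hd)

/-- **∂₁ of a 5-factor class**: `∂₁ (P/den(β₀,β₁,γ₁,γ₂,α)) = ibpQ1(P)/den(β₀,β₁+1,γ₁+1,γ₂,α)` (read in swapped coordinates) -/
theorem layerF_sw_der (P : MvPolynomial (Fin 3) ℚ) (β₀ β₁ γ₁ γ₂ α : ℕ) : ∀ y ∈ KZ.openOrderedSimplex 2, ∀ t ∈ Ioo (y 1) (y 0),
    HasDerivAt (fun s => WordLayer.layerF P β₀ β₁ γ₁ γ₂ α (sw3 (Fin.snoc y s)))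
      (WordLayer.layerF (ibpQ1 P β₁ γ₁) β₀ (β₁ + 1) (γ₁ + 1) γ₂ α (sw3 (Fin.snoc y t))) t := by
  intro y hy t ht
  obtain ⟨h1, h10, h0⟩ := (mem_simplex_two_iff y).1 hy
  have ht1 : y 1 < t := ht.1
  have ht0 : t < y 0 := ht.2
  have hy0 : y 0 ≠ 0 := by linarith
  have hs : t ≠ 0 := by linarith
  have hs' : (1 : ℝ) - t ≠ 0 := by linarith
  have hy1' : (1 : ℝ) - y 1 ≠ 0 := by linarith
  have hd : y 0 - y 1 ≠ 0 := by linarith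
  have hN := hasDerivAt_aeval_mid y t P
  have hE1 : HasDerivAt (fun s : ℝ => s ^ β₁) ((β₁ : ℝ) * t ^ (β₁ - 1) * 1) t := (hasDerivAt_id t).pow β₁
  have hE2 : HasDerivAt (fun s : ℝ => (1 - s) ^ γ₁) ((γ₁ : ℝ) * (1 - t) ^ (γ₁ - 1) * (-1)) t :=
    ((hasDerivAt_id t).const_sub 1).pow γ₁
  have hDen := (((hE1.const_mul (y 0 ^ β₀)).mul hE2).mul_const ((1 - y 1) ^ γ₂)).mul_const ((y 0 - y 1) ^ α)
  have hne : y 0 ^ β₀ * t ^ β₁ * (1 - t) ^ γ₁ * (1 - y 1) ^ γ₂ * (y 0 - y 1) ^ α ≠ 0 :=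
    mul_ne_zero (mul_ne_zero (mul_ne_zero (mul_ne_zero (pow_ne_zero _ hy0) (pow_ne_zero _ hs)) (pow_ne_zero _ hs'))
      (pow_ne_zero _ hy1')) (pow_ne_zero _ hd)
  have h := hN.div hDen hne
  show HasDerivAt (fun s => MvPolynomial.aeval (sw3 (Fin.snoc y s)) P /
    (y 0 ^ β₀ * s ^ β₁ * (1 - s) ^ γ₁ * (1 - y 1) ^ γ₂ * (y 0 - y 1) ^ α)) _ t
  refine h.congr_deriv ?_
  simp only [Pi.mul_apply]
  rw [WordLayer.natCast_mul_pow_pred β₁ t hs, WordLayer.natCast_mul_pow_pred γ₁ (1 - t) hs']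
  simp only [WordLayer.layerF, ibpQ1, map_add, map_mul, map_sub, map_natCast, MvPolynomial.aeval_X, map_one,
    sw3_snoc_zero, sw3_snoc_one, sw3_snoc_two]
  field_simp
  ring

end IBPT1
end Summit.KontsevichZagierPeriods.KontsevichZagierPeriods.Theorems.RootDecompZetaThreeFrontierWordMoves
end

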